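import Summits.HodgeConjecture.HodgeConjecture.Theorems.MarkmanPartnerTransportPicardThreeK3SquaresQuadraticRelation
import Summits.HodgeConjecture.HodgeConjecture.Theorems.MarkmanPartnerTransportPicardThreeK3SquaresKugaSatakeQuadraticThird

/-!
# Route MarkmanPartnerTransport · crux `PicardThreeK3Squares` (stmt-HodgeConjecture-19652) —
# the real-QUADRATIC GENERATOR exists at `22 − ρ(S) ∈ {6, 8, 10, 14}`; hence
# «Kuga–Satake for S ⇒ HC⁴(S × S)» at `ρ(S) ∈ {8, 12, 14, 16}`

Part 2 (prover seat hodge-nonav-19652-p1, gen 9). `…KugaSatakeSimilitude` / `…KugaSatakeQuadraticThird`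
prove HC⁴(S × S) modulo the Kuga–Satake statement for every projective K3 surface carrying a real-quadratic
generator `QuadGen[S]`; `…QuadraticRelation` supplies, for a non-CM non-scalar `S` with
«`d · m + ρ(S) = 22`, `d ≥ 2`, `m ≥ 3` forces `d = 2`», the relation `f² = a f + b` (`b ≠ 0`, `a² + 4b ≠ 0`)
and the cup-self-adjointness of any non-scalar transcendental Hodge endomorphism `f`. Here:

* `exists_quadraticGenerator_of_not_scalar` — **`QuadGen[S]` for every non-CM, non-scalar projective K3
  surface with `22 − ρ(S) ∈ {6, 8, 10, 14}`** (granted markings): `ψ := (2 + a²/b) f − (a/b) f² = 2f − a`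
  on `T(S)` is rational, type-preserving, kills `N¹`, has transcendental image, is cup-self-adjoint, has
  `ψ² = a² + 4b ≠ 0` on `T(S)`, and generates `End_Hdg T(S)` by the gen-8 engine
  (`OneCycle.generatedBy_or_hasComplexMultiplication_of_eigenvalue`: its `(2,0)`-eigenvalue `2 ev − a` is
  irrational).
* `hodgeConjectureFor_square_of_kugaSatake_of_rank` — **for every marked projective K3 surface `S` with
  `22 − ρ(S) ∈ {6, 8, 10, 14}`: the Kuga–Satake statement for `S` (`IsKSCorrespondenceAlgebraicBetti`)
  implies `HodgeConjectureFor 4 (S ⊗ S)`**, modulo Buskin's Thm. 1.1 (CM case), markings and Varesco's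
  Thm. 5.3 — trichotomy: CM (Buskin), scalar (kernel theorem), real-quadratic (this line).
* `hodgeConjectureFor_square_of_kugaSatake_of_picard_mem` — the same with `ρ(S) ∈ {8, 12, 14, 16}`.
* `picardThreeK3Squares_of_kugaSatake_of_oneCycle_low_ranks` — **crux #4 BY NAME**: granted Buskin,
  markings, Varesco's Thm. 5.3 and the Kuga–Satake statement on the non-CM `QuadGen` surfaces with
  `3 ≤ ρ(S) ≤ 16`, the crux follows from the one-cycle clause (`OneCycleOfDegree`, gen 8) ONLY at
  `ρ(S) ∈ {4, 6, 7, 10, 13}` and only off `QuadGen` — i.e. modulo Kuga–Satake the residue is RM of degree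
  `≥ 3` at those five Picard numbers.

CONDITIONAL on the Kuga–Satake statement (open in print for a general K3 surface); no definition, no sorry,
no new named fact; nothing here proves HC or the crux. `--supports stmt-HodgeConjecture-19652`.

References: M. Varesco, Math. Z. 305 (2023) Thm. 5.3, Conj. 4.2; Yu. G. Zarhin, J. reine angew. Math. 341
(1983) Thm. 1.5.1; B. van Geemen, Michigan Math. J. 56 (2008) Lemma 3.2; van Geemen–Schütt, Forum Math. Sigma
13 (2025) e2, §2.1, §4.8; N. Buskin, J. reine angew. Math. 755 (2019) Thm. 1.1.
-/

set_option linter.dupNamespace false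

noncomputable section

namespace Summit.HodgeConjecture.HodgeConjecture.Theorems.MarkmanPartnerTransport.KugaSatakeSimilitude

open scoped Manifold TensorProduct
open Module CategoryTheory MonoidalCategory CartesianMonoidalCategory Polynomial
open Literature.AlgebraicGeometry Literature.AlgebraicGeometry.Motives Literature.AlgebraicGeometry.HodgeTheory
open Literature.AlgebraicGeometry.Motives.HodgeStructure
open Literature.AlgebraicGeometry.Surfaces
open Literature.AlgebraicTopology.SingularHomology
open Summit.HodgeConjecture.HodgeConjecture.Theorems
open Summit.HodgeConjecture.HodgeConjecture.Theorems.NikulinTwinTransport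
open Summit.HodgeConjecture.HodgeConjecture.Theorems.AnchorExistenceCMFloor
open Summit.HodgeConjecture.HodgeConjecture.Theorems.MarkmanPartnerTransport.RealMultiplicationRanks
open Summit.HodgeConjecture.HodgeConjecture.Theorems.MarkmanPartnerTransport.OneCycle
open Summit.HodgeConjecture.HodgeConjecture.Theses.MarkmanPartnerTransport

variable {S : SchemeOver ℂ}

/-- `Transc[S, y]`: `y` is cup-orthogonal to `N¹(S)`. Local notation only. -/
local notation3 (prettyPrint := false) "Transc[" S ", " y "]" =>
  (∀ d ∈ algebraicClasses S 1, cupProduct (rfl : 2 * 1 + 2 * 1 = 2 * 2) y d = 0)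

/-- `Scalar[S]`: «`End_Hdg T(S) = ℚ`» (VERBATIM the clause of `HighPicard`). Local notation only. -/
local notation3 (prettyPrint := false) "Scalar[" S "]" =>
  (∀ (f : complexBetti S (2 * 1) →ₗ[ℂ] complexBetti S (2 * 1)),
    (∀ y, IsRationalClass y → IsRationalClass (f y)) →
    (∀ (i j : ℕ) y, IsOfHodgeType 2 S (2 * 1) i j y → IsOfHodgeType 2 S (2 * 1) i j (f y)) →
    (∀ d ∈ algebraicClasses S 1, f d = 0) →
    (∀ y : complexBetti S (2 * 1), ∀ d ∈ algebraicClasses S 1,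
      cupProduct (rfl : 2 * 1 + 2 * 1 = 2 * 2) (f y) d = 0) →
    ∃ a : ℚ, ∀ y : complexBetti S (2 * 1),
      (∀ d ∈ algebraicClasses S 1, cupProduct (rfl : 2 * 1 + 2 * 1 = 2 * 2) y d = 0) →
        f y = (a : ℂ) • y)

/-- `QuadGen[S]`: a real-quadratic generator (VERBATIM the clause of `…KugaSatakeQuadraticThird`). Local notation only. -/
local notation3 (prettyPrint := false) "QuadGen[" S "]" =>
  (∃ (ψ : complexBetti S (2 * 1) →ₗ[ℂ] complexBetti S (2 * 1)) (d : ℚ), d ≠ 0 ∧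
    (∀ y, IsRationalClass y → IsRationalClass (ψ y)) ∧
    (∀ (i j : ℕ) y, IsOfHodgeType 2 S (2 * 1) i j y → IsOfHodgeType 2 S (2 * 1) i j (ψ y)) ∧
    (∀ d' ∈ algebraicClasses S 1, ψ d' = 0) ∧
    (∀ y : complexBetti S (2 * 1), Transc[S, ψ y]) ∧
    (∀ y w : complexBetti S (2 * 1),
      cupProduct (rfl : 2 * 1 + 2 * 1 = 2 * 2) (ψ y) w = cupProduct (rfl : 2 * 1 + 2 * 1 = 2 * 2) y (ψ w)) ∧
    (∀ y : complexBetti S (2 * 1), Transc[S, y] → ψ (ψ y) = (d : ℂ) • y) ∧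
    TranscendentalEndomorphismsGeneratedBy S ψ)

/-- `MarkedK3[S, η, p, x]`: VERBATIM the `let MarkedK3 := …` binder of the route declaration
`PicardThreeK3Squares`. Local notation only. -/
local notation3 (prettyPrint := false) "MarkedK3[" S ", " η ", " p ", " x "]" =>
  (p ≠ 0 ∧ (IsIntegralClass p ∧
    (∀ q : complexBetti S (2 * 2), IsIntegralClass q → ∃ n : ℤ, q = n • p) ∧
    (∀ c : complexBetti S (2 * 1), IsIntegralClass c ↔ ∃ v : K3Index → ℤ, η c = fun i => (v i : ℂ)) ∧
    (∀ a b : complexBetti S (2 * 1),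
      cupProduct (rfl : 2 * 1 + 2 * 1 = 2 * 2) a b = k3Form (η a) (η b) • p) ∧
    IsOfHodgeType 2 S (2 * 1) 2 0 (LinearEquiv.symm η x) ∧
    (∀ τ : complexBetti S (2 * 1), IsOfHodgeType 2 S (2 * 1) 2 0 τ →
      ∃ t : ℂ, τ = t • LinearEquiv.symm η x)) ∧
    (k3Form x x = 0 ∧ 0 < (k3Form (star x) x).re ∧
      ∃ u : K3Index → ℤ, k3Form (fun i => (u i : ℂ)) x = 0 ∧ 0 < ∑ i, ∑ j, u i * k3Gram i j * u j))

/-- `Corr[μ, hS ; γ, y] = fst_*(snd^* y ∪ γ)` on `H²(S(ℂ); ℂ)`. Local notation only. -/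
local notation3 (prettyPrint := false) "Corr[" μ ", " hS " ; " γ ", " y "]" =>
  complexGysin μ (IsSmoothProjective.tensor_holds hS hS) hS
    (SemiCartesianMonoidalCategory.fst _ _) (rfl : 2 * 1 + 2 * 2 + 2 * 2 = 2 * 1 + 2 * (2 + 2))
    (cupProduct (rfl : 2 * 1 + 2 * 2 = 2 * 1 + 2 * 2)
      (complexBetti.map (SemiCartesianMonoidalCategory.snd _ _) (2 * 1) y) γ)

/-- `OneCycleOfDegree[S, hS]` (VERBATIM the clause of `…OneCycleThird`). Local notation only. -/
local notation3 (prettyPrint := false) "OneCycleOfDegree[" S ", " hS "]" =>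
  (∃ (k : ℕ) (e : complexBetti S (2 * 1) →ₗ[ℂ] complexBetti S (2 * 1)),
    (∀ j m : ℕ, 2 ≤ j → 3 ≤ m → k * j * m + Module.finrank ℂ ↥(algebraicClasses S 1) ≠ 22) ∧
    (∀ y, IsRationalClass y → IsRationalClass (e y)) ∧
    (∀ (i j : ℕ) y, IsOfHodgeType 2 S (2 * 1) i j y → IsOfHodgeType 2 S (2 * 1) i j (e y)) ∧
    (∃ γ ∈ algebraicClasses (S ⊗ S) 2, ∀ y : complexBetti S (2 * 1),
      e y = Corr[complexOrientationFamily, IsK3Surface.isSmoothProjective hS ; γ, y]) ∧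
    (∃ (σ₀ : complexBetti S (2 * 1)) (ev : ℂ), IsOfHodgeType 2 S (2 * 1) 2 0 σ₀ ∧ σ₀ ≠ 0 ∧
      e σ₀ = ev • σ₀ ∧ (minpoly ℚ ev).natDegree = k))

/-- **A non-CM, non-scalar projective K3 surface with `22 − ρ(S) ∈ {6, 8, 10, 14}` carries a
real-quadratic generator.** Hypotheses: markings; `d · m + ρ(S) = 22` with `d ≥ 2`, `m ≥ 3` forces
`d = 2`; `S` not CM; `End_Hdg T(S) ≠ ℚ`. Conclusion: `QuadGen[S]`. See the module docstring for the
proof (Zarhin's field and adjoint theorems, van Geemen's `m ≥ 3`, a degree-`2` minimal polynomial, and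
the gen-8 generation engine). [cite: Zarhin1983HodgeGroupsK3, Thm. 1.5.1 and Thm. 1.6]
[cite: Vangeemen2008, Lemma 3.2] [cite: Huybrechts2016K3, Ch. 3 Thm. 3.3.7 and Lemma 3.3.12] -/
theorem exists_quadraticGenerator_of_not_scalar (hmark : Huybrechts_K3_marking_exists) (hS : IsK3Surface S)
    (hρ : ∀ d m : ℕ, 2 ≤ d → 3 ≤ m → d * m + Module.finrank ℂ ↥(algebraicClasses S 1) = 22 → d = 2)
    (hCM : ¬ HasComplexMultiplication S) (hQ : ¬ Scalar[S]) : QuadGen[S] := by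
  classical
  have h4 : 2 * 1 + 2 * 1 = 2 * 2 := rfl

  -- linear combinations under the cup product
  have hcup_comb : ∀ (u v w : complexBetti S (2 * 1)) (s t : ℂ),
      cupProduct h4 (s • u + t • v) w = s • cupProduct h4 u w + t • cupProduct h4 v w := by
    intro u v w s t
    rw [map_add, map_smul, map_smul, LinearMap.add_apply, LinearMap.smul_apply, LinearMap.smul_apply]
  have hcup_comb' : ∀ (u v w : complexBetti S (2 * 1)) (s t : ℂ),
      cupProduct h4 w (s • u + t • v) = s • cupProduct h4 w u + t • cupProduct h4 w v := by
    intro u v w s t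
    rw [map_add, map_smul, map_smul]
  -- a non-scalar rational Hodge endomorphism `f` of `T`, extended by `0`
  push Not at hQ
  obtain ⟨f, hf_rat, hf_typ, hf_N, hf_perp, hfns⟩ := hQ
  have hρ' : ∀ d m : ℕ, 2 ≤ d → 3 ≤ m → d * m + Module.finrank ℂ ↥(algebraicClasses S 1) = 22 → d.Prime :=
    fun d m hd hm h => by rw [hρ d m hd hm h]; exact Nat.prime_two
  obtain ⟨a, b, hb, hd, hffT, hsa, hev20⟩ :=
    exists_quadratic_relation_selfAdjoint hmark hS hρ hCM f hf_rat hf_typ hf_N hf_perp hfns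
  have hb' : (b : ℂ) ≠ 0 := by exact_mod_cast hb
  -- a non-zero `(2,0)`-class and the eigenvalue of `f` on it
  obtain ⟨η, p₀, x, hp₀, ⟨-, -, -, -, hx20, hx20'⟩, -, hxpos, -⟩ := hmark S hS
  have hxne : η.symm x ≠ 0 := by
    intro h0
    have hx : x = 0 := by rw [← LinearEquiv.apply_symm_apply η x, h0, map_zero]
    subst hx
    simp [k3Form] at hxpos
  obtain ⟨ev, heσ⟩ : ∃ ev : ℂ, f (η.symm x) = ev • η.symm x := by
    obtain ⟨t, ht⟩ := hx20' (f (η.symm x)) (hf_typ 2 0 _ hx20)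
    exact ⟨t, ht⟩
  obtain ⟨hevrel, hev⟩ := hev20 (η.symm x) ev hx20 hxne heσ

  -- ### the generator `ψ = (2 + a²/b) f − (a/b) f² = 2f − a` on `T(S)`
  obtain ⟨q₁, hq₁⟩ : ∃ q : ℚ, q = 2 + a * a / b := ⟨_, rfl⟩
  obtain ⟨q₂, hq₂⟩ : ∃ q : ℚ, q = -(a / b) := ⟨_, rfl⟩
  have e1 : (q₁ : ℂ) + (q₂ : ℂ) * (a : ℂ) = 2 := by
    rw [hq₁, hq₂, Rat.cast_add, Rat.cast_neg, Rat.cast_div, Rat.cast_div, Rat.cast_mul, Rat.cast_ofNat, neg_mul,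
      div_mul_eq_mul_div, add_neg_cancel_right]
  have e2 : (q₂ : ℂ) * (b : ℂ) = -(a : ℂ) := by
    rw [hq₂, Rat.cast_neg, Rat.cast_div, neg_mul, div_mul_cancel₀ _ hb']
  -- `ψ := q₁ f + q₂ f²`
  let ψg : complexBetti S (2 * 1) →ₗ[ℂ] complexBetti S (2 * 1) := (q₁ : ℂ) • f + (q₂ : ℂ) • (f ∘ₗ f)
  have hψg : ∀ y, ψg y = (q₁ : ℂ) • f y + (q₂ : ℂ) • f (f y) := fun y => by
    simp only [ψg, LinearMap.add_apply, LinearMap.smul_apply, LinearMap.coe_comp, Function.comp_apply]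
  have hψ_rat : ∀ y, IsRationalClass y → IsRationalClass (ψg y) := fun y hy => by
    rw [hψg]; exact ((hf_rat y hy).smul q₁).add ((hf_rat _ (hf_rat y hy)).smul q₂)
  have hψ_typ : ∀ (i j : ℕ) y, IsOfHodgeType 2 S (2 * 1) i j y → IsOfHodgeType 2 S (2 * 1) i j (ψg y) :=
    fun i j y hy => by
      rw [hψg]; exact ((hf_typ i j y hy).smul _).add hS.1 ((hf_typ i j _ (hf_typ i j y hy)).smul _)
  have hψ_N : ∀ d ∈ algebraicClasses S 1, ψg d = 0 := fun d hd => by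
    rw [hψg, hf_N d hd, map_zero, smul_zero, smul_zero, add_zero]
  have hψ_perp : ∀ y : complexBetti S (2 * 1), Transc[S, ψg y] := fun y d hd => by
    rw [hψg, hcup_comb, hf_perp y d hd, hf_perp (f y) d hd, smul_zero, smul_zero, add_zero]
  have hψ_sa : ∀ y w : complexBetti S (2 * 1), cupProduct h4 (ψg y) w = cupProduct h4 y (ψg w) := by
    intro y w
    rw [hψg, hψg, hcup_comb, hcup_comb', hsa (f y) w, hsa y (f w), hsa y w]
  have hψT : ∀ y : complexBetti S (2 * 1), Transc[S, y] → ψg y = (2 : ℂ) • f y - (a : ℂ) • y := by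
    intro y hy
    rw [hψg, hffT y hy, smul_add, smul_smul, smul_smul, e2, ← add_assoc, ← add_smul, e1, neg_smul,
      sub_eq_add_neg]
  have hdC : ((a * a + 4 * b : ℚ) : ℂ) = (a : ℂ) * (a : ℂ) + 4 * (b : ℂ) := by
    rw [Rat.cast_add, Rat.cast_mul, Rat.cast_mul, Rat.cast_ofNat]
  have hψψ : ∀ y : complexBetti S (2 * 1), Transc[S, y] → ψg (ψg y) = ((a * a + 4 * b : ℚ) : ℂ) • y := by
    intro y hy
    rw [hψT _ (hψ_perp y), hψT y hy, LinearMap.map_sub, LinearMap.map_smul, LinearMap.map_smul, hffT y hy, hdC]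
    exact two_smul_sub_smul_identity (a : ℂ) (b : ℂ) (f y) y
  -- ### generation, by the gen-8 engine applied to `ψ` (its `(2,0)`-eigenvalue `2 ev − a` is irrational)
  have hffσ : f (f (η.symm x)) = (ev * ev) • (η.symm x) := by rw [heσ, LinearMap.map_smul, heσ, smul_smul]
  have hψσ : ψg (η.symm x) = ((q₁ : ℂ) * ev + (q₂ : ℂ) * (ev * ev)) • (η.symm x) := by
    rw [hψg, hffσ, heσ, smul_smul, smul_smul, ← add_smul]
  have hevψ : (q₁ : ℂ) * ev + (q₂ : ℂ) * (ev * ev) = 2 * ev - (a : ℂ) := by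
    linear_combination (q₂ : ℂ) * hevrel + ev * e1 + e2
  have hevψ' : ∀ q : ℚ, (q : ℂ) ≠ (q₁ : ℂ) * ev + (q₂ : ℂ) * (ev * ev) := by
    intro q hq
    apply hev ((q + a) / 2)
    push_cast
    linear_combination (hq.trans hevψ) / 2
  have hgen : TranscendentalEndomorphismsGeneratedBy S ψg := by
    rcases OneCycle.generatedBy_or_hasComplexMultiplication_of_eigenvalue hmark hS hρ' ψg hψ_rat hψ_typ
        ⟨η.symm x, _, hx20, hxne, hψσ, hevψ'⟩ with hgen | hCM'
    · exact hgen
    · exact absurd hCM' hCM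
  exact ⟨ψg, a * a + 4 * b, hd, hψ_rat, hψ_typ, hψ_N, hψ_perp, hψ_sa, hψψ, hgen⟩

/-! ### «Kuga–Satake for `S` ⇒ HC⁴(S × S)» at the ranks forcing `[E(S):ℚ] ≤ 2` -/

/-- **For a marked projective K3 surface with `22 − ρ(S) ∈ {6, 8, 10, 14}`, the Kuga–Satake statement for
`S` implies HC⁴(S × S)** — modulo Buskin's Thm. 1.1 (for the CM case), markings and Varesco's Thm. 5.3.
Trichotomy by logic: CM ⇒ `CMThird.hodgeConjectureFor_square_of_CM_of_buskin`; scalar ⇒ the kernel theorem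
`SquareGlueFree.hodgeConjectureFor_square_of_hodgeEndomorphisms_scalar`; else the real-quadratic generator
(`exists_quadraticGenerator_of_not_scalar`) and `hodgeConjectureFor_square_of_quadraticGenerator_of_kugaSatake`.
CONDITIONAL (Kuga–Satake hypothesis; facts Buskin2019, Varesco2023). [cite: Varesco2023, Thm. 5.3 and Conj. 4.2]
[cite: Vangeemen2008, Lemma 3.2] [cite: Buskin2019, Thm. 1.1] -/
theorem hodgeConjectureFor_square_of_kugaSatake_of_rank (hB : Buskin2019_hodgeIsometry_algebraic)
    (hmark : Huybrechts_K3_marking_exists)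
    (hVar : Varesco2023_transcendentalHodgeSimilitude_algebraic_of_kugaSatake_K3) (hS : IsK3Surface S)
    {η : complexBetti S (2 * 1) ≃ₗ[ℂ] (K3Index → ℂ)} {p : complexBetti S (2 * 2)} {x : K3Index → ℂ}
    (hM : MarkedK3[S, η, p, x])
    (hρ : ∀ d m : ℕ, 2 ≤ d → 3 ≤ m → d * m + Module.finrank ℂ ↥(algebraicClasses S 1) = 22 → d = 2)
    (hKS : IsKSCorrespondenceAlgebraicBetti hS.isSmoothProjective) :
    HodgeConjectureFor 4 (S ⊗ S) := by
  by_cases hCM : HasComplexMultiplication S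
  · exact CMThird.hodgeConjectureFor_square_of_CM_of_buskin hB hmark S hS hCM
  · by_cases hQ : Scalar[S]
    · exact SquareGlueFree.hodgeConjectureFor_square_of_hodgeEndomorphisms_scalar hS.isSmoothProjective hQ
    · exact hodgeConjectureFor_square_of_quadraticGenerator_of_kugaSatake hVar hS hM hKS
        (exists_quadraticGenerator_of_not_scalar hmark hS hρ hCM hQ)

/-- Arithmetic: `d · m + ρ = 22` with `d ≥ 2`, `m ≥ 3` and `ρ ∈ {8, 12, 14, 16}` forces `d = 2`. -/
theorem eq_two_of_mul_add_eq_of_mem {d m ρ : ℕ} (hd : 2 ≤ d) (hm : 3 ≤ m) (h : d * m + ρ = 22)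
    (hρ : ρ = 8 ∨ ρ = 12 ∨ ρ = 14 ∨ ρ = 16) : d = 2 := by
  have hd7 : d ≤ 7 := by nlinarith
  have hm9 : m ≤ 11 := by nlinarith
  interval_cases d <;> interval_cases m <;> omega

/-- Arithmetic: at `ρ ∈ {3, 5, 9, 11, 15}` there is no factorisation `22 − ρ = e · m`, `e ≥ 2`, `m ≥ 3`. -/
theorem mul_add_ne_of_mem {e m ρ : ℕ} (he : 2 ≤ e) (hm : 3 ≤ m)
    (hρ : ρ = 3 ∨ ρ = 5 ∨ ρ = 9 ∨ ρ = 11 ∨ ρ = 15) : e * m + ρ ≠ 22 := by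
  intro h
  have he7 : e ≤ 7 := by nlinarith
  have hm9 : m ≤ 11 := by nlinarith
  interval_cases e <;> interval_cases m <;> omega

/-- **«Kuga–Satake for `S` ⇒ HC⁴(S × S)» for every marked projective K3 surface with `ρ(S) ∈ {8, 12, 14, 16}`**
— modulo Buskin (CM case), markings and Varesco's Thm. 5.3. CONDITIONAL; credits nothing to HC.
[cite: Varesco2023, Thm. 5.3 and Conj. 4.2] [cite: Vangeemen2008, Lemma 3.2] -/
theorem hodgeConjectureFor_square_of_kugaSatake_of_picard_mem (hB : Buskin2019_hodgeIsometry_algebraic)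
    (hmark : Huybrechts_K3_marking_exists)
    (hVar : Varesco2023_transcendentalHodgeSimilitude_algebraic_of_kugaSatake_K3) (hS : IsK3Surface S)
    {η : complexBetti S (2 * 1) ≃ₗ[ℂ] (K3Index → ℂ)} {p : complexBetti S (2 * 2)} {x : K3Index → ℂ}
    (hM : MarkedK3[S, η, p, x])
    (hρ : Module.finrank ℂ ↥(algebraicClasses S 1) = 8 ∨ Module.finrank ℂ ↥(algebraicClasses S 1) = 12 ∨
      Module.finrank ℂ ↥(algebraicClasses S 1) = 14 ∨ Module.finrank ℂ ↥(algebraicClasses S 1) = 16)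
    (hKS : IsKSCorrespondenceAlgebraicBetti hS.isSmoothProjective) :
    HodgeConjectureFor 4 (S ⊗ S) :=
  hodgeConjectureFor_square_of_kugaSatake_of_rank hB hmark hVar hS hM
    (fun _ _ hd hm h => eq_two_of_mul_add_eq_of_mem hd hm h hρ) hKS

/-! ### The crux by name: the one-cycle clause is needed only at `ρ(S) ∈ {4, 6, 7, 10, 13}`, off `QuadGen` -/

/-- **`PicardThreeK3Squares` BY NAME, residue = RM of degree `≥ 3` at `ρ(S) ∈ {4, 6, 7, 10, 13}` (modulo
Kuga–Satake on the real-quadratic surfaces).** Granted Buskin's Thm. 1.1, markings, Varesco's Thm. 5.3 and the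
Kuga–Satake statement for the non-CM projective K3 surfaces with `3 ≤ ρ(S) ≤ 16` and a real-quadratic
generator, the crux follows from the one-cycle clause `OneCycleOfDegree[S, hS]` on the non-CM, non-scalar
surfaces WITHOUT a real-quadratic generator at `ρ(S) ∈ {4, 6, 7, 10, 13}` ONLY: at every other rank in
`3..16` either `22 − ρ(S)` admits no factorisation `d · m` (`d ≥ 2`, `m ≥ 3`), so `S` is scalar or CM
(`RealMultiplicationRanks.scalar_or_hasComplexMultiplication_of_forall_mul_add_ne`), or it forces `d = 2`
and `QuadGen[S]` holds (`exists_quadraticGenerator_of_not_scalar`). CONDITIONAL; credits nothing to HC.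
[cite: Varesco2023, Thm. 5.3 and Conj. 4.2] [cite: Vangeemen2008, Lemma 3.2] [cite: GeemenSchutt2023, §4.8 and Rem. 4.9]
[cite: Buskin2019, Thm. 1.1] -/
theorem picardThreeK3Squares_of_kugaSatake_of_oneCycle_low_ranks (hB : Buskin2019_hodgeIsometry_algebraic)
    (hmark : Huybrechts_K3_marking_exists)
    (hVar : Varesco2023_transcendentalHodgeSimilitude_algebraic_of_kugaSatake_K3)
    (hKS : ∀ (S : SchemeOver ℂ) (hS : IsK3Surface S), ¬ HasComplexMultiplication S →
      3 ≤ Module.finrank ℂ ↥(algebraicClasses S 1) → Module.finrank ℂ ↥(algebraicClasses S 1) ≤ 16 →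
      QuadGen[S] → IsKSCorrespondenceAlgebraicBetti hS.isSmoothProjective)
    (hOne : ∀ (S : SchemeOver ℂ) (hS : IsK3Surface S), ¬ HasComplexMultiplication S →
      (Module.finrank ℂ ↥(algebraicClasses S 1) = 4 ∨ Module.finrank ℂ ↥(algebraicClasses S 1) = 6 ∨
        Module.finrank ℂ ↥(algebraicClasses S 1) = 7 ∨ Module.finrank ℂ ↥(algebraicClasses S 1) = 10 ∨
        Module.finrank ℂ ↥(algebraicClasses S 1) = 13) →
      ¬ Scalar[S] → ¬ QuadGen[S] → OneCycleOfDegree[S, hS]) :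
    PicardThreeK3Squares := by
  refine picardThreeK3Squares_of_kugaSatake_of_oneCycle_off_quadratic hB hmark hVar hKS
    fun S hS hCM h3 h16 hQ hq ↦ ?_
  by_cases hlow : Module.finrank ℂ ↥(algebraicClasses S 1) = 4 ∨ Module.finrank ℂ ↥(algebraicClasses S 1) = 6 ∨
      Module.finrank ℂ ↥(algebraicClasses S 1) = 7 ∨ Module.finrank ℂ ↥(algebraicClasses S 1) = 10 ∨
      Module.finrank ℂ ↥(algebraicClasses S 1) = 13
  · exact hOne S hS hCM hlow hQ hq
  · exfalso
    by_cases hquad : Module.finrank ℂ ↥(algebraicClasses S 1) = 8 ∨ Module.finrank ℂ ↥(algebraicClasses S 1) = 12 ∨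
        Module.finrank ℂ ↥(algebraicClasses S 1) = 14 ∨ Module.finrank ℂ ↥(algebraicClasses S 1) = 16
    · exact hq (exists_quadraticGenerator_of_not_scalar hmark hS
        (fun _ _ hd hm h => eq_two_of_mul_add_eq_of_mem hd hm h hquad) hCM hQ)
    · have hodd : Module.finrank ℂ ↥(algebraicClasses S 1) = 3 ∨ Module.finrank ℂ ↥(algebraicClasses S 1) = 5 ∨
          Module.finrank ℂ ↥(algebraicClasses S 1) = 9 ∨ Module.finrank ℂ ↥(algebraicClasses S 1) = 11 ∨
          Module.finrank ℂ ↥(algebraicClasses S 1) = 15 := by omega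
      rcases RealMultiplicationRanks.scalar_or_hasComplexMultiplication_of_forall_mul_add_ne hmark hS
          (fun e m he hm => mul_add_ne_of_mem he hm hodd) with hsc | hcm
      · exact hQ hsc
      · exact hCM hcm

end Summit.HodgeConjecture.HodgeConjecture.Theorems.MarkmanPartnerTransport.KugaSatakeSimilitude

end
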